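import Summits.HodgeConjecture.HodgeConjecture.Theorems.CurveNetMordellWeilDeligneDescent
import Literature.AlgebraicGeometry.HodgeTheory.SaitoGrFDeRhamCurveNetHolds
import Literature.AlgebraicGeometry.HodgeTheory.HodgeRiemannPolarizabilityProofs

/-!
# Route `CurveNetMordellWeil` — support item `DeligneDescent` (stmt-HodgeConjecture-2786), closed

DELIGNE DESCENT (Hodge III Cor. 8.2.8 + semisimplicity of polarisable Hodge structures): a rational
`(q,q)`-class on a smooth projective `X` dying on `(X ∖ Y)(ℂ)`, `Y ⊊ X` closed, is a `ℂ`-combination of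
Gysin images `g_* β` of rational `(q-e, q-e)`-classes from smooth projective `W`, `dim W = n - e`,
`1 ≤ e ≤ q`.  The tree theorem `deligneDescent_of_facts` (`Theorems/CurveNetMordellWeilDeligneDescent.lean`)
proves the item CONDITIONALLY on the two Literature named facts
`Deligne1974_ker_restrictCompl_eq_iSup_range_complexGysin` (the kernel of restriction is the span of the
Gysin images from resolutions of the components) and `Voisin2025_hodgeClass_lift_complexGysin` (Hodge
classes lift along the Gysin maps).  Both are now DISCHARGED in the Literature library
(`Deligne1974_ker_restrictCompl_eq_iSup_range_complexGysin_holds`, from Deligne's Prop. 8.2.7;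
`Voisin2025_hodgeClass_lift_complexGysin_holds`, from real Hodge models, de Rham's theorem and
polarizability), so the item closes unconditionally.  No definition, no named-fact hypothesis, no sorry.
-/

set_option linter.dupNamespace false

noncomputable section

namespace Summit.HodgeConjecture.HodgeConjecture.Theorems

open Literature.AlgebraicGeometry.HodgeTheory

/-- **Item stmt-HodgeConjecture-2786 (`DeligneDescent`, route `CurveNetMordellWeil`)**, unconditionally:
the tree's conditional `deligneDescent_of_facts` fed with the landed discharges
`Deligne1974_ker_restrictCompl_eq_iSup_range_complexGysin_holds` and
`Voisin2025_hodgeClass_lift_complexGysin_holds`.  The type is literally the route decl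
`Summit.HodgeConjecture.HodgeConjecture.Theses.CurveNetMordellWeil.DeligneDescent`.
[cite: DeligneHodgeIII1974, Prop. 8.2.7 and Cor. 8.2.8] [cite: Voisin2025, Cor. 2.12 and Cor. 4.5]
[cite: Jannsen1990MixedMotives, §7, Thm. 7.9] -/
theorem curveNetMordellWeil_deligneDescent_proof :
    Summit.HodgeConjecture.HodgeConjecture.Theses.CurveNetMordellWeil.DeligneDescent :=
  deligneDescent_of_facts Deligne1974_ker_restrictCompl_eq_iSup_range_complexGysin_holds
    Voisin2025_hodgeClass_lift_complexGysin_holds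

end Summit.HodgeConjecture.HodgeConjecture.Theorems

end
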